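import Mathlib
import HarnessLib
import Summits.ValiantsHypothesis.ValiantsHypothesis.Theorems.MonotoneRestorationOrbitRestorationQPSquaresSpan
import Summits.ValiantsHypothesis.ValiantsHypothesis.Theorems.MonotoneRestorationOrbitRestorationQPLocalFactors

/-!
# Squares of matrix-symmetric affine products lie in the constant-treewidth span (SPAN currency; self-contained form)

Route MonotoneRestoration, crux `OrbitRestorationQP` (stmt-ValiantsHypothesis-18293), SPAN-currency lane of the open
sub-rung A_∞ (`stub_sigmaPiSigmaValue`), `ΠΣ` part.  Helper (`--supports`), def-free.  Item R4 of `BLOCK-LANE-g7g5.md` §3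
for the square theorem: the supports are obtained internally from the route's structure theorem
`LocalFactors.exists_rowColSupports_of_matrixSymmetric`, so the statement has exactly the hypotheses of the untwisted
`ΠΣ` theorem `CorePatterns.prod_mem_narrowSpan_of_untwisted_matrixSymmetric` WITHOUT the untwistedness:

* **`sq_mem_narrowSpan_of_matrixSymmetric`** — for every nonzero `f = C a · Π_i L_i` (`|ι| < C(n,k)` affine factors,
  `8 < n`, `1 ≤ k`, `4k ≤ n`) invariant under all row and all column permutations,
  `f² ∈ span_ℂ {hom_{F,n} : tw F ≤ 2k − 1}` — the square of EVERY matrix-symmetric `ΠΣ` polynomial has polynomial orbits in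
  span currency.  (A₁ in orbit currency, `MatrixAffine.qpOrbitRestorable_of_matrixSymmetric`, gives quasi-polynomial
  orbits for `f` itself; in span currency `f` itself remains open exactly at the SIGN-TWISTED support blocks — a square-root
  problem, template `…ColumnVandermondesNarrow.lean`.)

No registered stub is closed; the crux and VP ≠ VNP are not moved. [folklore]
-/

noncomputable section

open scoped Pointwise

-- `Summit.ValiantsHypothesis.ValiantsHypothesis.…` is the tree's single-conjunct layout (Sub = Summit).
set_option linter.dupNamespace false

namespace Summit.ValiantsHypothesis.ValiantsHypothesis.Theorems

namespace NormalisedFactors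

open MvPolynomial Finset Equiv ProductAction
open Literature.Computability.AlgebraicComplexity (homPoly)
open Literature.Combinatorics.SimpleGraph (treewidth)

variable {n : ℕ}

/-- **SQUARES OF MATRIX-SYMMETRIC AFFINE PRODUCTS HAVE POLYNOMIAL ORBITS (span currency, self-contained).**
[folklore; cite: DwivediPagoSeppelt2026, §8; DixonMortimer1996, Thm 5.2B] -/
theorem sq_mem_narrowSpan_of_matrixSymmetric {k : ℕ} (hn : 8 < n) (hk : 1 ≤ k) (h4k : 4 * k ≤ n)
    {ι : Type} [Fintype ι] (L : ι → MvPolynomial (Fin n × Fin n) ℂ) (a : ℂ)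
    (hL : ∀ i, (L i).totalDegree ≤ 1) (hcard : Fintype.card ι < n.choose k) (hf0 : C a * ∏ i, L i ≠ 0)
    (hrow : ∀ σ : Perm (Fin n), vact (K := ℂ) rowHom σ (C a * ∏ i, L i) = C a * ∏ i, L i)
    (hcol : ∀ τ : Perm (Fin n), vact (K := ℂ) colHom τ (C a * ∏ i, L i) = C a * ∏ i, L i) :
    (C a * ∏ i, L i) ^ 2 ∈ Submodule.span ℂ {p : MvPolynomial (Fin n × Fin n) ℂ |
        ∃ (a b : ℕ) (E : Multiset (Fin a × Fin b)),
          treewidth (SimpleGraph.fromRel fun u v : Fin a ⊕ Fin b =>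
            ∃ e ∈ E, u = Sum.inl e.1 ∧ v = Sum.inr e.2) ≤ 2 * k - 1 ∧ p = homPoly E n ℂ} := by
  classical
  -- split off the constant factors
  set P : ι → Prop := fun i => (L i).totalDegree = 1 with hP
  have hconst : ∀ i, ¬ P i → L i = C (constantCoeff (L i)) := by
    intro i hi
    have h0 : (L i).totalDegree = 0 := by have := hL i; simp only [hP] at hi; omega
    rw [constantCoeff_eq]
    exact (totalDegree_eq_zero_iff_eq_C (p := L i)).1 h0
  set ι₁ := {i // P i} with hι₁
  set L₁ : ι₁ → MvPolynomial (Fin n × Fin n) ℂ := fun i => L i with hL₁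
  set b : ℂ := ∏ i : {i // ¬ P i}, constantCoeff (L i) with hb
  have hsplit : C a * ∏ i, L i = C (a * b) * ∏ i : ι₁, L₁ i := by
    rw [← Fintype.prod_subtype_mul_prod_subtype P L, hb, map_mul, map_prod]
    have hc : (∏ i : {i // ¬ P i}, L (i : ι)) = ∏ i : {i // ¬ P i}, C (constantCoeff (L (i : ι))) :=
      Finset.prod_congr rfl fun i _ => hconst i i.2
    rw [hc]
    ring
  have hL₁1 : ∀ i : ι₁, (L₁ i).totalDegree = 1 := fun i => i.2
  have hf0₁ : C (a * b) * ∏ i : ι₁, L₁ i ≠ 0 := by rwa [← hsplit]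
  have hrow₁ : ∀ σ : Perm (Fin n), vact (K := ℂ) rowHom σ (C (a * b) * ∏ i : ι₁, L₁ i) = C (a * b) * ∏ i : ι₁, L₁ i := by
    intro σ; rw [← hsplit]; exact hrow σ
  have hcol₁ : ∀ τ : Perm (Fin n), vact (K := ℂ) colHom τ (C (a * b) * ∏ i : ι₁, L₁ i) = C (a * b) * ∏ i : ι₁, L₁ i := by
    intro τ; rw [← hsplit]; exact hcol τ
  have hfix₁ : ∀ σ τ : Perm (Fin n),
      rename (fun Q : Fin n × Fin n => (σ Q.1, τ Q.2)) (C (a * b) * ∏ i : ι₁, L₁ i) = C (a * b) * ∏ i : ι₁, L₁ i := by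
    intro σ τ
    rw [rename_prod_eq, hcol₁ τ, hrow₁ σ]
  -- the supports from the structure theorem (multiset form)
  set M : Multiset (MvPolynomial (Fin n × Fin n) ℂ) := (univ : Finset ι₁).val.map L₁ with hM
  have hMprod : C (a * b) * M.prod = C (a * b) * ∏ i : ι₁, L₁ i := by rw [hM, Finset.prod_eq_multiset_prod]
  have hML : ∀ ℓ ∈ M, ℓ.totalDegree ≤ 1 := by
    intro ℓ hℓ
    rw [hM, Multiset.mem_map] at hℓ
    obtain ⟨i, -, rfl⟩ := hℓ
    exact (hL₁1 i).le
  have hMcard : Multiset.card M < n.choose k := by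
    rw [hM, Multiset.card_map, Finset.card_val, Finset.card_univ]
    exact (Fintype.card_subtype_le P).trans_lt hcard
  have hMf0 : C (a * b) * M.prod ≠ 0 := by rwa [hMprod]
  have hMrow : ∀ σ : Perm (Fin n), vact (K := ℂ) rowHom σ (C (a * b) * M.prod) = C (a * b) * M.prod := by
    intro σ; rw [hMprod]; exact hrow₁ σ
  have hMcol : ∀ τ : Perm (Fin n), vact (K := ℂ) colHom τ (C (a * b) * M.prod) = C (a * b) * M.prod := by
    intro τ; rw [hMprod]; exact hcol₁ τ
  obtain ⟨R, S, R1, S1, R2, R3, S2, S3, -, -, hfac⟩ :=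
    LocalFactors.exists_rowColSupports_of_matrixSymmetric (K := ℂ) hn hk h4k hML hMcard hMf0 hMrow hMcol
  have hmem : ∀ i : ι₁, L₁ i ∈ M := fun i => by
    rw [hM]; exact Multiset.mem_map_of_mem _ (Finset.mem_univ_val i)
  have hsq := sq_mem_narrowSpan_of_matrixSymmetric_supports hk L₁ (a * b) hL₁1 hf0₁ hfix₁ R S R1 S1 R2 R3 S2 S3
    (fun i => (hfac (L₁ i) (hmem i)).1) (fun i => (hfac (L₁ i) (hmem i)).2.1)
    (fun i ρ hρ => (hfac (L₁ i) (hmem i)).2.2.1 ρ hρ) (fun i ρ hρ => (hfac (L₁ i) (hmem i)).2.2.2.1 ρ hρ)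
  rwa [← hsplit] at hsq

end NormalisedFactors

end Summit.ValiantsHypothesis.ValiantsHypothesis.Theorems

end
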